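import Summits.QuantumFields.YangMills.Theorems.FlatTubeReductionValleyRelocalisationOfGain
import HarnessLib

/-!
# Valley relocalisation of NEAR-TOP tube maximisers, one-coupling core — crux K1b `ValleyRelocalisation` of route `FlatTubeReduction`
# (item stmt-QuantumFields-25191) WITHOUT the first-level lower bound (rung R2b1 = RECORD-label femto gap; no summit statement is proved here)

Seat `ym-line-ftr-p1` g3 (prover).  Gen 2 of this seat (`…ValleyRelocalisationCore/OfGain`) proved the body of `ValleyRelocalisation` at
`(L, θ, κ)`, `L ≥ 2`, `κ > 1/3 − p`, from RED's proved valley gain, CONDITIONALLY on a first-level lower bound `(1 − Bλ_b)λ₀ ≤ λ₁` — open in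
the tree for `L ≥ 2`.  That lower bound enters the Agmon step at exactly ONE point: to know that the tube maximiser `ψ` itself has Rayleigh
quotient `≥ (1 − Bλ_b)λ₀`.  This module re-proves the one-coupling core with that single use replaced by the HYPOTHESIS ON `ψ`
`(1 − Bλ_b)·λ₀·‖ψ‖² ≤ ⟨ψ, K_βψ⟩` («near-top maximiser»):
* ★★ `relocalise_core_nearTop` — as `ValleyReloc.relocalise_core` (same side conditions: K2 shape at `θ`, `θ⋆`; gain on the far phase region;
  pinning inequality; smallness of the IMS defect and of the ground-state mass defect), near-top hypothesis in place of `hlow1`.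
The eventual-in-`β` statements (from RED's `ValleyGainAt`) are in the companion module `FlatTubeReductionValleyRelocalisationNearTop`.
WHY THIS SUFFICES FOR THE PARENT K1 `NearFlatRatioLaw` (module `FlatTubeReductionNearFlatDichotomyGlue`): if the tube maximiser is NOT near-top,
`ν < (1 − Bλ_b)λ₀`, K1's conclusion for every tube state follows from the PROVED one-site lower law `μ₁(L³β) ≥ e^{−Bλ_b}μ₀(L³β)`
(`oneSiteLevels_proof 1`, `B = |ε₁| + |C₂|`) with no relocalisation at all — so no first-level lower bound is needed on this line.
HONEST FRAMING: fixed spatial lattice `(ℤ/L)³`, bare coupling `β`; nothing here concerns infinite volume, the continuum limit, or the Clay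
Yang–Mills mass gap.  No definitions, no named facts, no `sorry`.
References: B. Simon, Ann. Phys. 146 (1983) 209 [cite: SimonB1983DiscreteSpectrum, §3]; M. Lüscher, NPB 219 (1983) 233 [cite: Luscher1983, §2–3];
Reed–Simon IV [cite: ReedSimonIV1978, Thm. XIII.1].
-/

set_option autoImplicit false

noncomputable section

open MeasureTheory Filter Topology Real
open Literature.MathematicalPhysics.QuantumFieldTheory
open Literature.MathematicalPhysics.QuantumLattice

namespace Summit.QuantumFields.YangMills.Theorems.FemtoTransferGap

namespace ValleyReloc

open Summit.QuantumFields.YangMills.Theorems.FemtoTransferGap.OffTube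

variable {L : ℕ} [NeZero L]

/-! ## §1 The one-coupling core with the near-top hypothesis -/

/-- ★★ **Valley relocalisation at one coupling for a NEAR-TOP dominating state**: as `relocalise_core`, with the first-level lower bound
`(1 − Bλ_b)λ₀ ≤ λ₁` replaced by the hypothesis `(1 − Bλ_b)λ₀‖ψ‖² ≤ ⟨ψ,K_βψ⟩` on the state `ψ` itself.
[cite: SimonB1983DiscreteSpectrum, §3] [cite: Luscher1983, §2–3] [cite: ReedSimonIV1978, Thm. XIII.1] -/
theorem relocalise_core_nearTop {β : ℝ} (hβ2 : 2 ≤ β) {θ θs κ δ γ B Cω C₁ : ℝ} (hδ : 0 < δ)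
    (htube : β ^ (-θs) ≤ β ^ (-θ)) (hpin : ((L : ℝ) * δ) ^ 2 / 2 ≤ β ^ (-(2 : ℝ) / 3 + 2 * κ))
    {Ω : GaugeConfig 3 L SU2 → ℝ} (hΩ : IsPhys Ω) (hΩpos : ∀ U, 0 < Ω U) (heig : transferApply β Ω = topValue su2Rep L β • Ω)
    (hK2 : ∀ f : GaugeConfig 3 L SU2 → ℝ, IsPhys f → l2 f Ω = 0 → ∃ f' : GaugeConfig 3 L SU2 → ℝ, IsPhys f' ∧ l2 f' Ω = 0 ∧
      (∀ U, β ^ (-θ) < wilsonAction su2Rep U → f' U = 0) ∧ l2 f' f' ≤ l2 f f ∧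
      qform su2Rep β f f ≤ qform su2Rep β f' f' + bareLambda β ^ 3 / L * topValue su2Rep L β * l2 f f)
    (hK2s : ∀ f : GaugeConfig 3 L SU2 → ℝ, IsPhys f → l2 f Ω = 0 → ∃ f' : GaugeConfig 3 L SU2 → ℝ, IsPhys f' ∧ l2 f' Ω = 0 ∧
      (∀ U, β ^ (-θs) < wilsonAction su2Rep U → f' U = 0) ∧ l2 f' f' ≤ l2 f f ∧
      qform su2Rep β f f ≤ qform su2Rep β f' f' + bareLambda β ^ 3 / L * topValue su2Rep L β * l2 f f)
    (hgain : ∀ f : GaugeConfig 3 L SU2 → ℝ, IsPhys f →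
      (∀ U, f U ≠ 0 → wilsonAction su2Rep U ≤ β ^ (-θs) ∧ Real.sin (innerPhase δ U) ≠ 0) →
      qform su2Rep β f f ≤ (1 - γ) * topValue su2Rep L β * l2 f f)
    (hγ1 : γ ≤ 1) (hB : 0 ≤ B) (hγB : (B + 1) * bareLambda β ≤ γ)
    (hCω : 0 ≤ Cω) (hω8 : Cω * bareLambda β ≤ 1 / 8)
    (hω : (Real.exp (-(β * β ^ (-θs))) * latCE L β) / topValue su2Rep L β +
        2 / (γ * topValue su2Rep L β) * ((1 + 2 / γ) * (Real.exp (-(β * β ^ (-θs))) * latCE L β) +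
          (1 / 2) * ((Fintype.card (Edge 3 L) : ℝ) ^ 2 * (8 * π / δ) ^ 2 * (3 / β) * latCE L β)) ≤ Cω * bareLambda β)
    (hC₁ : 0 ≤ C₁)
    (hε : (1 / 2) * ((Fintype.card (Edge 3 L) : ℝ) ^ 2 * (8 * π / δ) ^ 2 * (3 / β) * latCE L β) ≤
      C₁ * bareLambda β ^ 2 * topValue su2Rep L β)
    (hsmallv : bareLambda β * (4 * (2 + B * Cω + C₁)) ≤ 1)
    {ψ : GaugeConfig 3 L SU2 → ℝ} (hψ : IsPhys ψ) (hψΩ : l2 ψ Ω = 0)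
    (hnear : (1 - B * bareLambda β) * topValue su2Rep L β * l2 ψ ψ ≤ qform su2Rep β ψ ψ)
    (hmax : ∀ φ : GaugeConfig 3 L SU2 → ℝ, IsPhys φ → l2 φ Ω = 0 → (∀ U, β ^ (-θ) < wilsonAction su2Rep U → φ U = 0) →
      qform su2Rep β φ φ * l2 ψ ψ ≤ qform su2Rep β ψ ψ * l2 φ φ) :
    ∃ ψ' : GaugeConfig 3 L SU2 → ℝ, IsPhys ψ' ∧ l2 ψ' Ω = 0 ∧ (∀ U, β ^ (-θ) < wilsonAction su2Rep U → ψ' U = 0) ∧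
      (∀ U, (∃ (x : Site 3 L) (e : Edge 3 1), β ^ (-(2 : ℝ) / 3 + 2 * κ) < 2 - |((su2Rep (polyakovSite x U e)).trace).re|) → ψ' U = 0) ∧
      l2 ψ' ψ' ≤ l2 ψ ψ ∧
      qform su2Rep β ψ ψ ≤ qform su2Rep β ψ' ψ' +
        (16 + 8 * B * Cω + 32 * Cω ^ 2 + 8 * C₁) * bareLambda β ^ 2 * topValue su2Rep L β * l2 ψ ψ := by
  -- numbers
  have hβ : 0 < β := by linarith
  have hv0 : 0 < bareLambda β := by unfold bareLambda; exact Real.rpow_pos_of_pos (by positivity) _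
  have hv1 : bareLambda β ≤ 1 := by
    unfold bareLambda
    apply Real.rpow_le_one (by positivity) _ (by norm_num)
    rw [div_le_one hβ]; exact hβ2
  set v : ℝ := bareLambda β with hv
  set lam : ℝ := topValue su2Rep L β with hlam
  have hlam0 : 0 < lam := topValue_su2Rep_pos L β
  have hL1 : (1 : ℝ) ≤ (L : ℝ) := by exact_mod_cast NeZero.one_le
  have hLpos : (0 : ℝ) < (L : ℝ) := by linarith
  set s : ℝ := v ^ 3 / L with hs
  have hs0 : 0 ≤ s := by positivity
  have hv21 : v ^ 2 ≤ 1 := pow_le_one₀ hv0.le hv1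
  have hv32 : v ^ 3 ≤ v ^ 2 := pow_le_pow_of_le_one hv0.le hv1 (by norm_num)
  have hs2 : s ≤ v ^ 2 := by
    rw [hs, div_le_iff₀ hLpos]
    exact hv32.trans (le_mul_of_one_le_right (pow_nonneg hv0.le 2) hL1)
  have hs1 : s ≤ 1 := hs2.trans hv21
  set K : ℝ := 16 + 8 * B * Cω + 32 * Cω ^ 2 + 8 * C₁ with hK
  have hK1 : 1 ≤ K := by
    have h1 : 0 ≤ 8 * B * Cω := by positivity
    have h2 : 0 ≤ 32 * Cω ^ 2 := by positivity
    rw [hK]; linarith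
  have hP0 : 0 ≤ l2 ψ ψ := l2_self_nonneg ψ
  -- case `⟨ψ,Kψ⟩` already within budget: `ψ' = 0`
  by_cases hcase : qform su2Rep β ψ ψ ≤ K * v ^ 2 * lam * l2 ψ ψ
  · refine ⟨fun _ => 0, isPhys_const 0, l2_zero_left Ω, fun _ _ => rfl, fun _ _ => rfl, ?_, ?_⟩
    · rw [l2_zero_left]; exact hP0
    · rw [qform_zero, zero_add]; exact hcase
  -- otherwise `ψ` carries energy: `‖ψ‖² > 0`, `R(ψ) > sλ₀`
  have hbig : K * v ^ 2 * lam * l2 ψ ψ < qform su2Rep β ψ ψ := lt_of_not_ge hcase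
  have hqψ_le : qform su2Rep β ψ ψ ≤ lam * l2 ψ ψ := qform_le_topValue_mul_l2 hβ.le hψ
  have hψpos : 0 < l2 ψ ψ := by
    rcases hP0.eq_or_lt with h0 | hpos
    · exfalso
      rw [← h0] at hbig hqψ_le
      simp only [mul_zero] at hbig hqψ_le
      linarith
    · exact hpos
  set R : ℝ := qform su2Rep β ψ ψ / l2 ψ ψ with hR
  have hRq : R * l2 ψ ψ = qform su2Rep β ψ ψ := div_mul_cancel₀ _ hψpos.ne'
  have hRle : R ≤ lam := by rw [hR, div_le_iff₀ hψpos]; exact hqψ_le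
  have hsv : s * lam ≤ K * v ^ 2 * lam := by
    have h1 : s * lam ≤ v ^ 2 * lam := mul_le_mul_of_nonneg_right hs2 hlam0.le
    have h2 : v ^ 2 * lam ≤ K * (v ^ 2 * lam) := le_mul_of_one_le_left (by positivity) hK1
    linarith
  have hRs : s * lam * l2 ψ ψ < R * l2 ψ ψ := by
    rw [hRq]; exact lt_of_le_of_lt (mul_le_mul_of_nonneg_right hsv hP0) hbig
  have hRs' : s * lam < R := lt_of_mul_lt_mul_right hRs hP0
  -- the near-top hypothesis, as a bound on `R`
  have hRnear : (1 - B * v) * lam ≤ R := by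
    rw [hR, le_div_iff₀ hψpos]; exact hnear
  -- the level `ν = R + sλ₀` dominates every physical `f ⊥ Ω` (K2 at `θ` + maximality)
  set ν : ℝ := R + s * lam with hν
  have hνdom : ∀ f : GaugeConfig 3 L SU2 → ℝ, IsPhys f → l2 f Ω = 0 → qform su2Rep β f f ≤ ν * l2 f f :=
    fun f hf hfΩ => qform_le_of_tubeMax hβ.le hψ hψpos hmax hK2 hf hfΩ
  -- truncate `ψ` to the `θ⋆`-tube
  obtain ⟨φ, hφ, hφΩ, hφT, hφle, hφq⟩ := hK2s ψ hψ hψΩ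
  have hφpos : 0 < l2 φ φ := by
    rcases (l2_self_nonneg φ).eq_or_lt with h0 | hpos
    · exfalso
      have hqφ : qform su2Rep β φ φ ≤ lam * l2 φ φ := qform_le_topValue_mul_l2 hβ.le hφ
      rw [← h0, mul_zero] at hqφ
      have : qform su2Rep β ψ ψ ≤ s * lam * l2 ψ ψ := by linarith [hφq]
      linarith [hRs, hRq]
    · exact hpos
  have hmaxφ : (ν - 2 * s * lam) * l2 φ φ ≤ qform su2Rep β φ φ := by
    have h1 : (R - s * lam) * l2 ψ ψ ≤ qform su2Rep β φ φ := by linarith [hφq, hRq]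
    have h2 : (R - s * lam) * l2 φ φ ≤ (R - s * lam) * l2 ψ ψ := mul_le_mul_of_nonneg_left hφle (by linarith)
    have e : ν - 2 * s * lam = R - s * lam := by rw [hν]; ring
    rw [e]; exact h2.trans h1
  -- the phase and the remaining inputs of the Agmon step
  have hγpos : 0 < γ := lt_of_lt_of_le (by positivity) hγB
  have hΛ : 0 ≤ 8 * π / δ := by positivity
  have hωbound := ground_far_mass_le hβ hΩ heig (measurable_innerPhase δ) hΛ (abs_innerPhase_sub_le hδ)
    (fun g U => innerPhase_gaugeTransform δ g U) (fun k c hc U => innerPhase_twist δ k hc U) (β ^ (-θs)) hγpos hgain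
  set ω : ℝ := (Real.exp (-(β * β ^ (-θs))) * latCE L β) / lam +
        2 / (γ * lam) * ((1 + 2 / γ) * (Real.exp (-(β * β ^ (-θs))) * latCE L β) +
          (1 / 2) * ((Fintype.card (Edge 3 L) : ℝ) ^ 2 * (8 * π / δ) ^ 2 * (3 / β) * latCE L β)) with hωdef
  set ε : ℝ := (1 / 2) * ((Fintype.card (Edge 3 L) : ℝ) ^ 2 * (8 * π / δ) ^ 2 * (3 / β) * latCE L β) with hεdef
  have hlat : 0 < latCE L β := latCE_pos hβ.le
  have hε0 : 0 ≤ ε := by positivity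
  have hω0 : 0 ≤ ω := by positivity
  have hωv : ω ≤ Cω * v := hω
  have hω1 : ω ≤ 1 / 8 := hωv.trans hω8
  have hν2 : ν ≤ 2 * lam := by
    have : s * lam ≤ lam := mul_le_of_le_one_left hlam0.le hs1
    rw [hν]; linarith
  have hτ1 : B * v ≤ 1 := by linarith [hγB, hγ1, hv0]
  have hτγ : B * v < γ := by linarith [hγB, hv0]
  have hνlow : (1 - B * v) * lam ≤ ν := by
    have : 0 ≤ s * lam := by positivity
    rw [hν]; linarith [hRnear]
  have hγτ : v ≤ γ - B * v := by linarith
  have hsmall : 4 * ((2 * s + B * v * ω) * lam + ε) ≤ (γ - B * v) * lam := by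
    have h1 : B * v * ω ≤ B * Cω * v ^ 2 := by
      have := mul_le_mul_of_nonneg_left hωv (mul_nonneg hB hv0.le)
      linarith
    have h2 : 2 * s ≤ 2 * v ^ 2 := by linarith [hs2]
    have h12 : (2 * s + B * v * ω) * lam ≤ (2 * v ^ 2 + B * Cω * v ^ 2) * lam := mul_le_mul_of_nonneg_right (by linarith) hlam0.le
    have h3 : 4 * ((2 * s + B * v * ω) * lam + ε) ≤ 4 * ((2 * v ^ 2 + B * Cω * v ^ 2) * lam + C₁ * v ^ 2 * lam) := by
      linarith [h12, hε]
    have h4 : 4 * ((2 * v ^ 2 + B * Cω * v ^ 2) * lam + C₁ * v ^ 2 * lam) = (v * (4 * (2 + B * Cω + C₁))) * (v * lam) := by ring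
    have h5 : (v * (4 * (2 + B * Cω + C₁))) * (v * lam) ≤ 1 * (v * lam) :=
      mul_le_mul_of_nonneg_right hsmallv (by positivity)
    have h6 : 1 * (v * lam) ≤ (γ - B * v) * lam := by
      rw [one_mul]; exact mul_le_mul_of_nonneg_right hγτ hlam0.le
    linarith
  -- ★ the Agmon step
  obtain ⟨ψ₀, hψ₀, hψ₀Ω, hψ₀supp, hn4, hq₀⟩ :=
    agmon_relocalise hβ hΩ hΩpos heig (measurable_innerPhase δ) hΛ (abs_innerPhase_sub_le hδ)
      (fun g U => innerPhase_gaugeTransform δ g U) (fun k c hc U => innerPhase_twist δ k hc U) (innerPhase_mem δ)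
      (β ^ (-θs)) hφ hφΩ hφT hφpos (ν := ν) (σ := 2 * s) (γ := γ) (τ := B * v) (ω := ω)
      hνdom hν2 (by positivity) hmaxφ hgain (by positivity) hτ1 hτγ hνlow hω0 hω1 hωbound hsmall
  -- the loss is `≤ K v² λ₀`
  have hloss : (8 * (2 * s + B * v * ω) + 32 * ω ^ 2) * lam + 8 * ε ≤ K * v ^ 2 * lam := by
    have h1 : B * v * ω ≤ B * Cω * v ^ 2 := by
      have := mul_le_mul_of_nonneg_left hωv (mul_nonneg hB hv0.le)
      linarith
    have h2 : ω ^ 2 ≤ Cω ^ 2 * v ^ 2 := by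
      have := pow_le_pow_left₀ hω0 hωv 2
      rw [mul_pow] at this; exact this
    have h3 : (8 * (2 * s + B * v * ω) + 32 * ω ^ 2) * lam ≤ (8 * (2 * v ^ 2 + B * Cω * v ^ 2) + 32 * (Cω ^ 2 * v ^ 2)) * lam :=
      mul_le_mul_of_nonneg_right (by linarith [hs2]) hlam0.le
    have h4 : (8 * (2 * v ^ 2 + B * Cω * v ^ 2) + 32 * (Cω ^ 2 * v ^ 2)) * lam + 8 * (C₁ * v ^ 2 * lam) = K * v ^ 2 * lam := by
      rw [hK]; ring
    linarith [hε]
  -- rescale `ψ₀` to the norm of `ψ`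
  have hn₀pos : 0 < l2 ψ₀ ψ₀ := by linarith
  set c : ℝ := Real.sqrt (l2 ψ ψ / l2 ψ₀ ψ₀) with hc
  have hc2 : c ^ 2 = l2 ψ ψ / l2 ψ₀ ψ₀ := Real.sq_sqrt (div_nonneg hP0 hn₀pos.le)
  have hc2n : c ^ 2 * l2 ψ₀ ψ₀ = l2 ψ ψ := by rw [hc2, div_mul_cancel₀ _ hn₀pos.ne']
  have hψ'phys : IsPhys (c • ψ₀) := hψ₀.smul c
  have hnψ' : l2 (c • ψ₀) (c • ψ₀) = l2 ψ ψ := by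
    rw [l2_smul_left, l2_comm ψ₀ (c • ψ₀), l2_smul_left, ← hc2n]; ring
  have hqψ' : qform su2Rep β (c • ψ₀) (c • ψ₀) = c ^ 2 * qform su2Rep β ψ₀ ψ₀ := by
    rw [qform_smul_left, qform_smul_right β c hψ₀ hψ₀]; ring
  refine ⟨c • ψ₀, hψ'phys, ?_, ?_, ?_, hnψ'.le, ?_⟩
  · rw [l2_smul_left, hψ₀Ω, mul_zero]
  · intro U hU
    have h0 : ψ₀ U = 0 := by
      by_contra hne
      have := (hψ₀supp U hne).1
      linarith [htube]
    simp only [Pi.smul_apply, smul_eq_mul, h0, mul_zero]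
  · intro U hU
    have h0 : ψ₀ U = 0 := by
      by_contra hne
      obtain ⟨z, hz⟩ := exists_orbitDist_lt_of_cos_ne_zero hδ (hψ₀supp U hne).2
      exact not_unpinned_of_orbitDist_twist3_lt z hz hpin hU
    simp only [Pi.smul_apply, smul_eq_mul, h0, mul_zero]
  · -- `⟨ψ,Kψ⟩ = R‖ψ‖² ≤ ν‖ψ‖² = c²ν‖ψ₀‖² ≤ c²(⟨ψ₀,Kψ₀⟩ + LOSS‖ψ₀‖²) = ⟨ψ',Kψ'⟩ + LOSS‖ψ‖²`
    have h1 : qform su2Rep β ψ ψ ≤ ν * l2 ψ ψ := by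
      have : 0 ≤ s * lam * l2 ψ ψ := by positivity
      rw [← hRq, hν]; linarith
    have hq₀' : (ν - (8 * (2 * s + B * v * ω) + 32 * ω ^ 2) * lam - 8 * ε) * l2 ψ₀ ψ₀ ≤ qform su2Rep β ψ₀ ψ₀ := hq₀
    have h2 : ν * l2 ψ₀ ψ₀ ≤ qform su2Rep β ψ₀ ψ₀ + K * v ^ 2 * lam * l2 ψ₀ ψ₀ := by
      have := mul_le_mul_of_nonneg_right hloss hn₀pos.le
      linarith [hq₀']
    have h3 : ν * l2 ψ ψ ≤ qform su2Rep β (c • ψ₀) (c • ψ₀) + K * v ^ 2 * lam * l2 ψ ψ := by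
      have := mul_le_mul_of_nonneg_left h2 (sq_nonneg c)
      rw [hqψ']
      calc ν * l2 ψ ψ = c ^ 2 * (ν * l2 ψ₀ ψ₀) := by rw [← hc2n]; ring
        _ ≤ c ^ 2 * (qform su2Rep β ψ₀ ψ₀ + K * v ^ 2 * lam * l2 ψ₀ ψ₀) := this
        _ = c ^ 2 * qform su2Rep β ψ₀ ψ₀ + K * v ^ 2 * lam * (c ^ 2 * l2 ψ₀ ψ₀) := by ring
        _ = c ^ 2 * qform su2Rep β ψ₀ ψ₀ + K * v ^ 2 * lam * l2 ψ ψ := by rw [hc2n]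
    exact h1.trans h3

end ValleyReloc

end Summit.QuantumFields.YangMills.Theorems.FemtoTransferGap

end
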